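import Mathlib
import Literature.Analysis.Complex.ExtremalLengthProofs
import Literature.NumberTheory.Transcendental.KZEllipticPiecePeriod
import Summits.KontsevichZagierPeriods.KontsevichZagierPeriods.Theses.UnfoldedStokes

/-!
# `HyperellipticRiemannRelation` (stmt-KontsevichZagierPeriods-3522), line `SketchIdeator2`:
# kernel calculus I — Cauchy–Riemann for the hyperelliptic kernels

Auxiliary file for the registered stub `stub_kernelCalculus` (file
`UnfoldedStokesHyperellipticRiemannRelationStubKernelCalculus.lean`). For rational branch points
`e : Fin 5 → ℚ` and `Φ(z) = ∏ⱼ √(z − eⱼ)` (principal square roots, entering through the defining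
hypothesis `hΦ : ∀ z, Φ z = …`) we record, sorry-free and without definitions:

* `Φ′ = Φ · ½ Σⱼ (z − eⱼ)⁻¹` on the open upper half-plane (`(√z)′ = z^{−1/2}/2` on the slit plane,
  Mathlib `Complex.hasDerivAt_sqrt`), `(1/Φ)′ = −Φ⁻¹ · ½ Σⱼ (z − eⱼ)⁻¹`,
  `(z/Φ)′ = (1 − (z/2) Σⱼ (z − eⱼ)⁻¹)/Φ`; `Φ` is continuous on the CLOSED upper half-plane (the
  principal square root is continuous from above on the cut,
  `Literature.Analysis.Complex.ExtremalLength.continuousOn_sqrt_im_nonneg`);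
* for the kernels `K(x₀,x₁,s) = (x₁+is)/(Φ(x₀+is)Φ(x₁+is))`, `k(x,s) = (x+is)/Φ(x+is)` the
  transport laws `∂ₛ K = i K′`, `∂_τ K(τ−a,τ,s) = K′(τ−a,τ,s)` (`s > 0`; likewise for `k`), their
  readings in the compactified height `s = σ/(1−σ)`, and continuity in `s ∈ [0,∞)` off the branch
  points. Registered auxiliary stub: `stub_kernelCalculusAux` (the transport law for `K`).
References: Kontsevich–Zagier 2001, §1.2 rule (3); Farkas–Kra 1992, III.3 (`dx/y`, `x dx/y`).
-/

noncomputable section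

namespace Summit.KontsevichZagierPeriods.UnfoldedStokes.HyperellipticRiemannRelationLine

open Set Filter Topology Complex

namespace KernelCalculus

/-! ## The function `Φ = ∏ⱼ √(· − eⱼ)` -/

section Phi

variable {e : Fin 5 → ℚ} {Φ : ℂ → ℂ}

/-- A point whose real part is not `eⱼ` is not the branch point `eⱼ`. [folklore] -/
theorem ne_branch_of_re_ne {z : ℂ} {j : Fin 5} (h : z.re ≠ (e j : ℝ)) : z ≠ ((e j : ℝ) : ℂ) :=
  fun hz => h (by rw [hz, Complex.ofReal_re])

/-- A point off the real axis is not a branch point. [folklore] -/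
theorem ne_branch_of_im_ne {z : ℂ} (h : z.im ≠ 0) (j : Fin 5) : z ≠ ((e j : ℝ) : ℂ) :=
  fun hz => h (by rw [hz, Complex.ofReal_im])

/-- `x + is ≠ eⱼ` when `x ≠ eⱼ`. [folklore] -/
theorem lin_ne_branch_of_re {X Y : ℝ} {j : Fin 5} (h : X ≠ (e j : ℝ)) :
    (X : ℂ) + (Y : ℂ) * Complex.I ≠ ((e j : ℝ) : ℂ) :=
  ne_branch_of_re_ne (by simpa using h)

/-- `x + is ≠ eⱼ` when `s ≠ 0`. [folklore] -/
theorem lin_ne_branch_of_im {X Y : ℝ} (h : Y ≠ 0) (j : Fin 5) :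
    (X : ℂ) + (Y : ℂ) * Complex.I ≠ ((e j : ℝ) : ℂ) :=
  ne_branch_of_im_ne (by simpa using h) j

variable (hΦ : ∀ z, Φ z = ∏ j : Fin 5, Complex.sqrt (z - ((e j : ℝ) : ℂ)))
include hΦ

/-- `Φ(z) ≠ 0` off the branch points. [folklore] -/
theorem Phi_ne_zero {z : ℂ} (hz : ∀ j, z ≠ ((e j : ℝ) : ℂ)) : Φ z ≠ 0 := by
  rw [hΦ, Finset.prod_ne_zero_iff]
  exact fun j _ => Literature.NumberTheory.Transcendental.complexSqrt_ne_zero (sub_ne_zero.2 (hz j))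

/-- **`Φ` is holomorphic on the upper half-plane**, `Φ′(z) = Φ(z) · ½ Σⱼ (z − eⱼ)⁻¹` (product
rule; each `z − eⱼ` lies in the slit plane). [folklore] -/
theorem hasDerivAt_Phi {z : ℂ} (hz : 0 < z.im) :
    HasDerivAt Φ (Φ z * (2⁻¹ * ∑ j : Fin 5, (z - ((e j : ℝ) : ℂ))⁻¹)) z := by
  have hΦ' : Φ = fun z => ∏ j : Fin 5, Complex.sqrt (z - ((e j : ℝ) : ℂ)) := funext hΦ
  have hslit : ∀ j : Fin 5, z - ((e j : ℝ) : ℂ) ∈ slitPlane := fun j =>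
    Or.inr (by simpa using hz.ne')
  have hf : ∀ j ∈ (Finset.univ : Finset (Fin 5)),
      HasDerivAt (fun w => Complex.sqrt (w - ((e j : ℝ) : ℂ)))
        (Complex.sqrt (z - ((e j : ℝ) : ℂ)) * (2 * (z - ((e j : ℝ) : ℂ)))⁻¹) z := by
    intro j _
    refine ((Complex.hasDerivAt_sqrt (hslit j)).comp_sub_const z _).congr_deriv ?_
    rw [show (-1 / 2 : ℂ) = 2⁻¹ - 1 by norm_num,
      Complex.cpow_sub _ _ (slitPlane_ne_zero (hslit j)), Complex.cpow_one, Complex.sqrt]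
    field_simp
  rw [hΦ']
  refine (HasDerivAt.fun_finsetProd hf).congr_deriv ?_
  simp only [smul_eq_mul]
  rw [Finset.mul_sum, Finset.mul_sum]
  refine Finset.sum_congr rfl fun i _ => ?_
  rw [← mul_assoc, Finset.prod_erase_mul _ _ (Finset.mem_univ i), mul_inv]

/-- `Φ` is continuous on the closed upper half-plane. [folklore] -/
theorem continuousOn_Phi : ContinuousOn Φ {w : ℂ | 0 ≤ w.im} := by
  have hΦ' : Φ = fun z => ∏ j : Fin 5, Complex.sqrt (z - ((e j : ℝ) : ℂ)) := funext hΦ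
  rw [hΦ']
  refine continuousOn_finsetProd _ fun j _ => ?_
  refine Literature.Analysis.Complex.ExtremalLength.continuousOn_sqrt_im_nonneg.comp (by fun_prop)
    fun w hw => ?_
  simpa using hw

/-- `(1/Φ)′ = −Φ⁻¹ · ½ Σⱼ (z − eⱼ)⁻¹` on the upper half-plane. [folklore] -/
theorem hasDerivAt_inv_Phi {z : ℂ} (hz : 0 < z.im) :
    HasDerivAt (fun w => (Φ w)⁻¹) (-(Φ z)⁻¹ * (2⁻¹ * ∑ j : Fin 5, (z - ((e j : ℝ) : ℂ))⁻¹)) z := by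
  have hne : Φ z ≠ 0 := Phi_ne_zero hΦ (ne_branch_of_im_ne hz.ne')
  refine ((hasDerivAt_Phi hΦ hz).inv hne).congr_deriv ?_
  field_simp

/-- `(z/Φ)′ = (1 − (z/2) Σⱼ (z − eⱼ)⁻¹)/Φ` on the upper half-plane. [folklore] -/
theorem hasDerivAt_div_Phi {z : ℂ} (hz : 0 < z.im) :
    HasDerivAt (fun w => w / Φ w)
      ((1 - z / 2 * ∑ j : Fin 5, (z - ((e j : ℝ) : ℂ))⁻¹) / Φ z) z := by
  have hne : Φ z ≠ 0 := Phi_ne_zero hΦ (ne_branch_of_im_ne hz.ne')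
  refine ((hasDerivAt_id' z).div (hasDerivAt_Phi hΦ hz) hne).congr_deriv ?_
  field_simp

/-- **The ordered pair kernel along a real path.** For two paths `p₀, p₁ : ℝ → ℂ` in the upper
half-plane with the same velocity `v`, `t ↦ p₁/(Φ(p₀)Φ(p₁))` has derivative
`v · (1 − (p₁/2) Σⱼ ((p₀−eⱼ)⁻¹ + (p₁−eⱼ)⁻¹))/(Φ(p₀)Φ(p₁))` (product and chain rules).
[folklore] -/
theorem hasDerivAt_pair {p₀ p₁ : ℝ → ℂ} {v : ℂ} {t : ℝ} (hp₀ : HasDerivAt p₀ v t)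
    (hp₁ : HasDerivAt p₁ v t) (h₀ : 0 < (p₀ t).im) (h₁ : 0 < (p₁ t).im) :
    HasDerivAt (fun t => p₁ t / (Φ (p₀ t) * Φ (p₁ t)))
      (v * ((1 - p₁ t / 2 * ∑ j : Fin 5, ((p₀ t - ((e j : ℝ) : ℂ))⁻¹ + (p₁ t - ((e j : ℝ) : ℂ))⁻¹)) /
        (Φ (p₀ t) * Φ (p₁ t)))) t := by
  have hne₀ : Φ (p₀ t) ≠ 0 := Phi_ne_zero hΦ (ne_branch_of_im_ne h₀.ne')
  have hne₁ : Φ (p₁ t) ≠ 0 := Phi_ne_zero hΦ (ne_branch_of_im_ne h₁.ne')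
  have hAB := ((hasDerivAt_div_Phi hΦ h₁).comp t hp₁).mul ((hasDerivAt_inv_Phi hΦ h₀).comp t hp₀)
  have hfun : (fun t => p₁ t / (Φ (p₀ t) * Φ (p₁ t))) =
      ((fun w => w / Φ w) ∘ p₁) * ((fun w => (Φ w)⁻¹) ∘ p₀) := by
    funext t
    simp only [Pi.mul_apply, Function.comp_apply]
    ring
  rw [hfun]
  refine hAB.congr_deriv ?_
  simp only [Function.comp_apply]
  rw [Finset.sum_add_distrib]
  field_simp
  ring

/-- **The one-point kernel along a real path**: `t ↦ p/Φ(p)` has derivative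
`v · (1 − (p/2) Σⱼ (p−eⱼ)⁻¹)/Φ(p)`. [folklore] -/
theorem hasDerivAt_single {p : ℝ → ℂ} {v : ℂ} {t : ℝ} (hp : HasDerivAt p v t)
    (h : 0 < (p t).im) :
    HasDerivAt (fun t => p t / Φ (p t))
      (v * ((1 - p t / 2 * ∑ j : Fin 5, (p t - ((e j : ℝ) : ℂ))⁻¹) / Φ (p t))) t := by
  rw [mul_comm]
  exact (hasDerivAt_div_Phi hΦ h).comp t hp

/-- `s ↦ Φ(x + is)` is continuous on `[0, ∞)`. [folklore] -/
theorem continuousOn_Phi_path (x : ℝ) :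
    ContinuousOn (fun s : ℝ => Φ ((x : ℂ) + (s : ℂ) * Complex.I)) (Ici 0) := by
  refine (continuousOn_Phi hΦ).comp (by fun_prop) fun s hs => ?_
  simpa using hs

/-- `Φ(x + is) ≠ 0` for every `s` when `x` is off the branch points. [folklore] -/
theorem Phi_path_ne_zero {x : ℝ} (hx : ∀ j, x ≠ (e j : ℝ)) (s : ℝ) :
    Φ ((x : ℂ) + (s : ℂ) * Complex.I) ≠ 0 :=
  Phi_ne_zero hΦ fun _ => lin_ne_branch_of_re (hx _)

/-! ## The simplex kernel `K` and the one-point kernel `k` -/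

section Kernels

variable {K K' : ℝ → ℝ → ℝ → ℂ} {k k' : ℝ → ℝ → ℂ}
  (hK : ∀ x₀ x₁ s, K x₀ x₁ s = ((x₁ : ℂ) + (s : ℂ) * Complex.I) /
      (Φ ((x₀ : ℂ) + (s : ℂ) * Complex.I) * Φ ((x₁ : ℂ) + (s : ℂ) * Complex.I)))
  (hK' : ∀ x₀ x₁ s, K' x₀ x₁ s =
      (1 - ((x₁ : ℂ) + (s : ℂ) * Complex.I) / 2 *
        ∑ j : Fin 5, (((x₀ : ℂ) + (s : ℂ) * Complex.I - ((e j : ℝ) : ℂ))⁻¹ +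
          ((x₁ : ℂ) + (s : ℂ) * Complex.I - ((e j : ℝ) : ℂ))⁻¹)) /
      (Φ ((x₀ : ℂ) + (s : ℂ) * Complex.I) * Φ ((x₁ : ℂ) + (s : ℂ) * Complex.I)))
  (hk : ∀ x s, k x s = ((x : ℂ) + (s : ℂ) * Complex.I) / Φ ((x : ℂ) + (s : ℂ) * Complex.I))
  (hk' : ∀ x s, k' x s = (1 - ((x : ℂ) + (s : ℂ) * Complex.I) / 2 *
      ∑ j : Fin 5, ((x : ℂ) + (s : ℂ) * Complex.I - ((e j : ℝ) : ℂ))⁻¹) /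
      Φ ((x : ℂ) + (s : ℂ) * Complex.I))

section K

include hK

/-- `s ↦ K(x₀,x₁,s)` is continuous on `[0,∞)` when `x₀, x₁` are off the branch points (the square
root is continuous from above on the cut, and `Φ(x + is) ≠ 0`). [folklore] -/
theorem continuousOn_K {x₀ x₁ : ℝ} (h₀ : ∀ j, x₀ ≠ (e j : ℝ)) (h₁ : ∀ j, x₁ ≠ (e j : ℝ)) :
    ContinuousOn (fun s : ℝ => K x₀ x₁ s) (Ici 0) := by
  have hfun : (fun s : ℝ => K x₀ x₁ s) = fun s : ℝ => ((x₁ : ℂ) + (s : ℂ) * Complex.I) /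
        (Φ ((x₀ : ℂ) + (s : ℂ) * Complex.I) * Φ ((x₁ : ℂ) + (s : ℂ) * Complex.I)) :=
    funext fun s => hK x₀ x₁ s
  rw [hfun]
  refine ContinuousOn.div (by fun_prop) ((continuousOn_Phi_path hΦ x₀).mul
    (continuousOn_Phi_path hΦ x₁)) fun s _ => ?_
  exact mul_ne_zero (Phi_path_ne_zero hΦ h₀ s) (Phi_path_ne_zero hΦ h₁ s)

include hK'

/-- **Transport law in the height** (Cauchy–Riemann): `∂ₛ K(x₀,x₁,s) = i K′(x₀,x₁,s)` for `s > 0`.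
[cite: KontsevichZagier2001, §1.2 rule (3)] -/
theorem hasDerivAt_K_s (x₀ x₁ : ℝ) {s : ℝ} (hs : 0 < s) :
    HasDerivAt (fun s : ℝ => K x₀ x₁ s) (Complex.I * K' x₀ x₁ s) s := by
  -- the vertical paths `s ↦ x + is` have velocity `i`
  have hp : ∀ x : ℝ, HasDerivAt (fun s : ℝ => (x : ℂ) + (s : ℂ) * I) I s := fun x => by
    simpa using ((hasDerivAt_id s).ofReal_comp.mul_const I).const_add (x : ℂ)
  have h := hasDerivAt_pair hΦ (hp x₀) (hp x₁) (by simpa using hs) (by simpa using hs)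
  have hfun : (fun s : ℝ => K x₀ x₁ s) = fun s : ℝ => ((x₁ : ℂ) + (s : ℂ) * Complex.I) /
        (Φ ((x₀ : ℂ) + (s : ℂ) * Complex.I) * Φ ((x₁ : ℂ) + (s : ℂ) * Complex.I)) :=
    funext fun s => hK x₀ x₁ s
  rw [hfun, hK']
  exact h

/-- **Transport law along the joint translation**: `∂_τ K(τ−a, τ, s) = K′(τ−a, τ, s)` for `s > 0`.
[cite: KontsevichZagier2001, §1.2 rule (3)] -/
theorem hasDerivAt_K_τ (a : ℝ) {s : ℝ} (hs : 0 < s) (τ : ℝ) :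
    HasDerivAt (fun τ : ℝ => K (τ - a) τ s) (K' (τ - a) τ s) τ := by
  -- the horizontal paths `τ ↦ (τ − a) + is`, `τ ↦ τ + is` have velocity `1`
  have hp₀ : HasDerivAt (fun τ : ℝ => ((τ - a : ℝ) : ℂ) + (s : ℂ) * I) 1 τ := by
    simpa using (((hasDerivAt_id τ).sub_const a).ofReal_comp).add_const ((s : ℂ) * I)
  have hp₁ : HasDerivAt (fun τ : ℝ => (τ : ℂ) + (s : ℂ) * I) 1 τ := by
    simpa using ((hasDerivAt_id τ).ofReal_comp).add_const ((s : ℂ) * I)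
  have h := hasDerivAt_pair hΦ hp₀ hp₁ (by simpa using hs) (by simpa using hs)
  have hfun : (fun τ : ℝ => K (τ - a) τ s) = fun τ : ℝ => ((τ : ℂ) + (s : ℂ) * Complex.I) /
        (Φ (((τ - a : ℝ) : ℂ) + (s : ℂ) * Complex.I) * Φ ((τ : ℂ) + (s : ℂ) * Complex.I)) :=
    funext fun τ => hK (τ - a) τ s
  rw [hfun, hK', ← one_mul ((1 - _) / _)]
  exact h

end K

section k

include hk

/-- `s ↦ k(x,s)` is continuous on `[0,∞)` when `x` is off the branch points. [folklore] -/
theorem continuousOn_k {x : ℝ} (hx : ∀ j, x ≠ (e j : ℝ)) :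
    ContinuousOn (fun s : ℝ => k x s) (Ici 0) := by
  have hfun : (fun s : ℝ => k x s) =
      fun s : ℝ => ((x : ℂ) + (s : ℂ) * Complex.I) / Φ ((x : ℂ) + (s : ℂ) * Complex.I) :=
    funext fun s => hk x s
  rw [hfun]
  exact ContinuousOn.div (by fun_prop) (continuousOn_Phi_path hΦ x) fun s _ =>
    Phi_path_ne_zero hΦ hx s

include hk'

/-- `∂ₛ k(x,s) = i k′(x,s)` for `s > 0`. [cite: KontsevichZagier2001, §1.2 rule (3)] -/
theorem hasDerivAt_k_s (x : ℝ) {s : ℝ} (hs : 0 < s) :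
    HasDerivAt (fun s : ℝ => k x s) (Complex.I * k' x s) s := by
  have hp : HasDerivAt (fun s : ℝ => (x : ℂ) + (s : ℂ) * I) I s := by
    simpa using ((hasDerivAt_id s).ofReal_comp.mul_const I).const_add (x : ℂ)
  have h := hasDerivAt_single hΦ hp (by simpa using hs)
  have hfun : (fun s : ℝ => k x s) =
      fun s : ℝ => ((x : ℂ) + (s : ℂ) * Complex.I) / Φ ((x : ℂ) + (s : ℂ) * Complex.I) :=
    funext fun s => hk x s
  rw [hfun, hk']
  exact h

/-- `∂_τ k(τ,s) = k′(τ,s)` for `s > 0`. [cite: KontsevichZagier2001, §1.2 rule (3)] -/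
theorem hasDerivAt_k_τ {s : ℝ} (hs : 0 < s) (τ : ℝ) :
    HasDerivAt (fun τ : ℝ => k τ s) (k' τ s) τ := by
  have hp : HasDerivAt (fun τ : ℝ => (τ : ℂ) + (s : ℂ) * I) 1 τ := by
    simpa using ((hasDerivAt_id τ).ofReal_comp).add_const ((s : ℂ) * I)
  have h := hasDerivAt_single hΦ hp (by simpa using hs)
  have hfun : (fun τ : ℝ => k τ s) =
      fun τ : ℝ => ((τ : ℂ) + (s : ℂ) * Complex.I) / Φ ((τ : ℂ) + (s : ℂ) * Complex.I) :=
    funext fun τ => hk τ s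
  rw [hfun, hk', ← one_mul ((1 - _) / _)]
  exact h

end k

/-! ## The transport laws read in the compactified height `s = σ/(1−σ)` -/

omit hΦ in
/-- `(σ/(1−σ))′ = (1−σ)⁻²` for `σ ≠ 1`. [folklore] -/
theorem hasDerivAt_height {σ : ℝ} (hσ : σ ≠ 1) :
    HasDerivAt (fun σ : ℝ => σ / (1 - σ)) (1 / (1 - σ) ^ 2) σ := by
  have h1 : HasDerivAt (fun σ : ℝ => 1 - σ) (-1) σ := by
    simpa using (hasDerivAt_id' σ).const_sub (1:ℝ)
  refine ((hasDerivAt_id' σ).div h1 (sub_ne_zero.2 (Ne.symm hσ))).congr_deriv ?_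
  field_simp
  ring

omit hΦ in
/-- `σ/(1−σ) > 0` for `σ ∈ (0,1)`. [folklore] -/
theorem height_pos {σ : ℝ} (hσ : σ ∈ Ioo (0:ℝ) 1) : 0 < σ / (1 - σ) :=
  div_pos hσ.1 (sub_pos.2 hσ.2)

section K

include hK hK'

/-- `∂_σ Im K(x₀,x₁,σ/(1−σ)) = (1−σ)⁻² Re K′(x₀,x₁,σ/(1−σ))` for `σ ∈ (0,1)` (height transport
law read in the compactified height). [cite: KontsevichZagier2001, §1.2 rule (3)] -/
theorem hasDerivAt_imK_σ (x₀ x₁ : ℝ) {σ : ℝ} (hσ : σ ∈ Ioo (0:ℝ) 1) :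
    HasDerivAt (fun σ : ℝ => (K x₀ x₁ (σ / (1 - σ))).im)
      (1 / (1 - σ) ^ 2 * (K' x₀ x₁ (σ / (1 - σ))).re) σ := by
  have h3 := Complex.imCLM.hasFDerivAt.comp_hasDerivAt σ
    ((hasDerivAt_K_s hΦ hK hK' x₀ x₁ (height_pos hσ)).scomp σ (hasDerivAt_height hσ.2.ne))
  simp only [Function.comp_def, Complex.imCLM_apply] at h3
  refine h3.congr_deriv ?_
  rw [Complex.smul_im, smul_eq_mul, Complex.mul_im, Complex.I_re, Complex.I_im]
  ring

/-- `∂_τ Re K(τ−a, τ, s) = Re K′(τ−a, τ, s)` for `s > 0`.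
[cite: KontsevichZagier2001, §1.2 rule (3)] -/
theorem hasDerivAt_reK_τ (a : ℝ) {s : ℝ} (hs : 0 < s) (τ : ℝ) :
    HasDerivAt (fun τ : ℝ => (K (τ - a) τ s).re) ((K' (τ - a) τ s).re) τ :=
  Complex.reCLM.hasFDerivAt.comp_hasDerivAt τ (hasDerivAt_K_τ hΦ hK hK' a hs τ)

end K

section k

include hk hk'

/-- `∂_σ Re k(x,σ/(1−σ)) = −(1−σ)⁻² Im k′(x,σ/(1−σ))` for `σ ∈ (0,1)`.
[cite: KontsevichZagier2001, §1.2 rule (3)] -/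
theorem hasDerivAt_rek_σ (x : ℝ) {σ : ℝ} (hσ : σ ∈ Ioo (0:ℝ) 1) :
    HasDerivAt (fun σ : ℝ => (k x (σ / (1 - σ))).re)
      (-(1 / (1 - σ) ^ 2 * (k' x (σ / (1 - σ))).im)) σ := by
  have h3 := Complex.reCLM.hasFDerivAt.comp_hasDerivAt σ
    ((hasDerivAt_k_s hΦ hk hk' x (height_pos hσ)).scomp σ (hasDerivAt_height hσ.2.ne))
  simp only [Function.comp_def, Complex.reCLM_apply] at h3
  refine h3.congr_deriv ?_
  rw [Complex.smul_re, smul_eq_mul, Complex.mul_re, Complex.I_re, Complex.I_im]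
  ring

/-- `∂_τ Im k(τ,s) = Im k′(τ,s)` for `s > 0`. [cite: KontsevichZagier2001, §1.2 rule (3)] -/
theorem hasDerivAt_imk_τ {s : ℝ} (hs : 0 < s) (τ : ℝ) :
    HasDerivAt (fun τ : ℝ => (k τ s).im) ((k' τ s).im) τ :=
  Complex.imCLM.hasFDerivAt.comp_hasDerivAt τ (hasDerivAt_k_τ hΦ hk hk' hs τ)

end k

end Kernels

end Phi

end KernelCalculus

/-! ## Registered auxiliary stub: the transport law for the simplex kernel -/

/-- **Cauchy–Riemann transport law for the ordered simplex kernel.** With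
`Φ(z) = ∏ⱼ √(z − eⱼ)`, `K(x₀,x₁,s) = (x₁+is)/(Φ(x₀+is)Φ(x₁+is))` and
`K′ = (1 − (z₁/2) Σⱼ ((z₀−eⱼ)⁻¹ + (z₁−eⱼ)⁻¹))/(Φ(z₀)Φ(z₁))`: for `s > 0`,
`∂ₛ K(x₀,x₁,s) = i K′(x₀,x₁,s)` and `∂_τ K(τ−a,τ,s) = K′(τ−a,τ,s)` — the one-variable holomorphic
family `ζ ↦ (x₁+ζ)/(Φ(x₀+ζ)Φ(x₁+ζ))` read along the vertical and the horizontal direction.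
[cite: KontsevichZagier2001, §1.2 rule (3)] -/
theorem stub_kernelCalculusAux : ∀ (e : Fin 5 → ℚ) (Φ : ℂ → ℂ), (∀ z, Φ z = ∏ j : Fin 5,
    Complex.sqrt (z - ((e j : ℝ) : ℂ))) → ∀ (K K' : ℝ → ℝ → ℝ → ℂ), (∀ x₀ x₁ s, K x₀ x₁ s =
    ((x₁ : ℂ) + (s : ℂ) * Complex.I) / (Φ ((x₀ : ℂ) + (s : ℂ) * Complex.I) * Φ ((x₁ : ℂ) +
    (s : ℂ) * Complex.I))) → (∀ x₀ x₁ s, K' x₀ x₁ s = (1 - ((x₁ : ℂ) + (s : ℂ) * Complex.I) / 2 *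
    ∑ j : Fin 5, (((x₀ : ℂ) + (s : ℂ) * Complex.I - ((e j : ℝ) : ℂ))⁻¹ + ((x₁ : ℂ) + (s : ℂ) *
    Complex.I - ((e j : ℝ) : ℂ))⁻¹)) / (Φ ((x₀ : ℂ) + (s : ℂ) * Complex.I) * Φ ((x₁ : ℂ) +
    (s : ℂ) * Complex.I))) → ∀ (x₀ x₁ a s : ℝ), 0 < s → HasDerivAt (fun s : ℝ => K x₀ x₁ s)
    (Complex.I * K' x₀ x₁ s) s ∧ ∀ τ : ℝ, HasDerivAt (fun τ : ℝ => K (τ - a) τ s)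
    (K' (τ - a) τ s) τ := by
  intro e Φ hΦ K K' hK hK' x₀ x₁ a s hs
  exact ⟨KernelCalculus.hasDerivAt_K_s hΦ hK hK' x₀ x₁ hs,
    fun τ => KernelCalculus.hasDerivAt_K_τ hΦ hK hK' a hs τ⟩

end Summit.KontsevichZagierPeriods.UnfoldedStokes.HyperellipticRiemannRelationLine
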